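import Mathlib.LinearAlgebra.FiniteDimensional.Lemmas
import Mathlib.LinearAlgebra.Pi
import Literature.Computability.AlgebraicComplexity.AsymptoticSpectrum
import Literature.Computability.AlgebraicComplexity.FlatteningRank
import HarnessLib

/-!
# Gauge points are universal spectral points — proved

Topic `Literature/Computability/AlgebraicComplexity`; sibling of `AsymptoticSpectrum.lean`, whose
named fact `gaugePoint_isUniversalSpectralPoint K` (Christandl–Vrana–Zuiddam, JAMS 36 (2023) =
arXiv:1709.07851, Example 1.4 "Gauge points": "The maps `ζ⁽ⁱ⁾` are universal spectral points";
Strassen, J. reine angew. Math. 384 (1988), (3.10)) is DISCHARGED here: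
`gaugePoint_isUniversalSpectralPoint_holds`.

## The printed claim and the proof architecture

CVZ Example 1.4 defines, for `f : K^{n₁} × K^{n₂} × K^{n₃} → K`, `ζ⁽ⁱ⁾(f) = dim Vᵢ`, the rank of the
`i`-th flattening `K^{nᵢ} → K^{∏_{j≠i} nⱼ}` (the tree's `gaugePoint₁/₂/₃`, `AsymptoticSpectrum.lean`;
`ℕ`-valued form `flatteningRank`, `FlatteningRank.lean`), and states that these are universal
spectral points, i.e. (CVZ §1.2, p. 7) maps `ξ` with `ξ(s ⊕ t) = ξ(s) + ξ(t)`,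
`ξ(s ⊗ t) = ξ(s) ξ(t)`, `ξ(⟨1⟩) = 1`, `s ≤ t ⇒ ξ(s) ≤ ξ(t)` (and `ξ ≥ 0`). No proof is printed in
CVZ (it is Strassen's (3.10)); the standard linear-algebra argument is formalised:

* additivity — the flattening of `s ⊕ t` is block-diagonal: its slices are the extensions by zero
  of the slices of `s` and of `t` to two disjoint blocks of coordinates, so the span is an internal
  direct sum (`finrank_span_range_sumElim`, `finrank_span_range_extend`,
  `flatteningRank_directSum`);
* multiplicativity and monotonicity — the flattening of `s ⊗ t` is the Kronecker product of the
  flattenings, and a restriction `s = (A ⊗ B ⊗ C) t` multiplies the flattening by matrices on both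
  sides: `flatteningRank_kronecker`, `flatteningRank_mono` (already in `FlatteningRank.lean`);
* normalisation — `⟨1⟩` has the single nonzero slice `1` (`flatteningRank_unitTensor_one`);
* `ζ⁽²⁾`, `ζ⁽³⁾` are `ζ⁽¹⁾` of the tensor with permuted legs (definitionally:
  `gaugePoint₂_eq_gaugePoint₁_swap`, `gaugePoint₃_eq_gaugePoint₁_swap`), and `⊕`, `⊗`, `⟨1⟩`, `≤`
  commute with leg permutations (`directSumTensor_swap₁₂`, …, `TensorRestrictsTo.swap₁₃`).

## Main statements

* `gaugePoint₁_isUniversalSpectralPoint`, `gaugePoint₂_isUniversalSpectralPoint`,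
  `gaugePoint₃_isUniversalSpectralPoint` — each gauge point is in `Δ(T)`;
* `gaugePoint_isUniversalSpectralPoint_holds K : gaugePoint_isUniversalSpectralPoint K`;
* `asymptoticSpectrum_nonempty` — `Δ(T) ≠ ∅` over every field.

## References

* M. Christandl, P. Vrana, J. Zuiddam, *Universal points in the asymptotic spectrum of tensors*,
  J. Amer. Math. Soc. 36 (2023) 31–79, Example 1.4 and §1.2 (p. 7). [ChristandlVranaZuiddam2023]
* V. Strassen, *The asymptotic spectrum of tensors*, J. reine angew. Math. 384 (1988) 102–152,
  (3.10) — cited through CVZ.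

## Mathlib

`Function.ExtendByZero.linearMap` (extension by zero as a linear map),
`Submodule.finrank_sup_add_finrank_inf_eq`, `Submodule.equivMapOfInjective`,
`finrank_span_singleton`. `Literature.Barriers.MatrixMultiplication.flatteningRank_unitTensor`
(`ζ⁽¹⁾(⟨n⟩) = n`) lives in a barrier file downstream of this topic; only the case `n = 1` is needed
and it is proved here directly rather than importing a barrier file into the topic literature.
-/

noncomputable section

open scoped BigOperators
open Module Submodule

namespace Literature.Computability.AlgebraicComplexity

universe u

/-! ## Leg permutations commute with `⊕`, `⊗`, `⟨1⟩` and restriction -/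

section Swap

variable {K : Type u} [CommSemiring K]
variable {ι κ μ ι' κ' μ' : Type*}

/-- Swapping the first two legs commutes with the direct sum. [folklore] -/
theorem directSumTensor_swap₁₂ (s : ι → κ → μ → K) (t : ι' → κ' → μ' → K) :
    (fun b a c => directSumTensor s t a b c) =
      directSumTensor (fun b a c => s a b c) (fun b a c => t a b c) := by
  funext b a c
  rcases a with a | a <;> rcases b with b | b <;> rcases c with c | c <;> rfl

/-- Moving the third leg to the front commutes with the direct sum. [folklore] -/
theorem directSumTensor_swap₁₃ (s : ι → κ → μ → K) (t : ι' → κ' → μ' → K) :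
    (fun c a b => directSumTensor s t a b c) =
      directSumTensor (fun c a b => s a b c) (fun c a b => t a b c) := by
  funext c a b
  rcases a with a | a <;> rcases b with b | b <;> rcases c with c | c <;> rfl

/-- Swapping the first two legs commutes with the Kronecker product. [folklore] -/
theorem kroneckerTensor_swap₁₂ (s : ι → κ → μ → K) (t : ι' → κ' → μ' → K) :
    (fun b a c => kroneckerTensor s t a b c) =
      kroneckerTensor (fun b a c => s a b c) (fun b a c => t a b c) := rfl

/-- Moving the third leg to the front commutes with the Kronecker product. [folklore] -/
theorem kroneckerTensor_swap₁₃ (s : ι → κ → μ → K) (t : ι' → κ' → μ' → K) :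
    (fun c a b => kroneckerTensor s t a b c) =
      kroneckerTensor (fun c a b => s a b c) (fun c a b => t a b c) := rfl

variable (K) in
/-- `⟨1⟩` is invariant under swapping the first two legs. [folklore] -/
theorem unitTensor_one_swap₁₂ : (fun b a c => unitTensor K 1 a b c) = unitTensor K 1 := by
  funext b a c
  rw [unitTensor_one, unitTensor_one]

variable (K) in
/-- `⟨1⟩` is invariant under moving the third leg to the front. [folklore] -/
theorem unitTensor_one_swap₁₃ : (fun c a b => unitTensor K 1 a b c) = unitTensor K 1 := by
  funext c a b
  rw [unitTensor_one, unitTensor_one]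

/-- Restriction is compatible with swapping the first two legs (swap the first two matrices). [folklore] -/
theorem TensorRestrictsTo.swap₁₂ [Fintype ι] [Fintype κ] [Fintype μ] {t : ι → κ → μ → K}
    {s : ι' → κ' → μ' → K} (h : TensorRestrictsTo t s) :
    TensorRestrictsTo (fun b a c => t a b c) (fun b a c => s a b c) := by
  obtain ⟨A, B, C, h⟩ := h
  refine ⟨B, A, C, fun b' a' c' => ?_⟩
  dsimp only
  rw [h a' b' c', Finset.sum_comm]
  exact Finset.sum_congr rfl fun b _ => Finset.sum_congr rfl fun a _ =>
    Finset.sum_congr rfl fun c _ => by ring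

/-- Restriction is compatible with moving the third leg to the front. [folklore] -/
theorem TensorRestrictsTo.swap₁₃ [Fintype ι] [Fintype κ] [Fintype μ] {t : ι → κ → μ → K}
    {s : ι' → κ' → μ' → K} (h : TensorRestrictsTo t s) :
    TensorRestrictsTo (fun c a b => t a b c) (fun c a b => s a b c) := by
  obtain ⟨A, B, C, h⟩ := h
  refine ⟨C, A, B, fun c' a' b' => ?_⟩
  dsimp only
  rw [h a' b' c']
  calc ∑ a, ∑ b, ∑ c, A a' a * B b' b * C c' c * t a b c
      = ∑ a, ∑ c, ∑ b, A a' a * B b' b * C c' c * t a b c :=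
        Finset.sum_congr rfl fun a _ => Finset.sum_comm
    _ = ∑ c, ∑ a, ∑ b, A a' a * B b' b * C c' c * t a b c := Finset.sum_comm
    _ = ∑ c, ∑ a, ∑ b, C c' c * A a' a * B b' b * t a b c :=
        Finset.sum_congr rfl fun c _ => Finset.sum_congr rfl fun a _ =>
          Finset.sum_congr rfl fun b _ => by ring

end Swap

/-! ## Additivity of the flattening rank under direct sum -/

section DirectSum

variable {K : Type u} [Field K]
variable {ι κ μ ι' κ' μ' : Type*}

/-- **Internal direct sums of spans.** If `E₁ : V₁ → W`, `E₂ : V₂ → W` are injective linear maps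
with disjoint ranges (`range E₁ ⊓ range E₂ = ⊥`), then for families `u`, `v` the span of
`Sum.elim (E₁ ∘ u) (E₂ ∘ v)` has dimension `dim span u + dim span v`
(`dim (U ⊕ U') = dim U + dim U'`). [folklore] -/
theorem finrank_span_range_sumElim {V₁ V₂ W : Type*} [AddCommGroup V₁] [Module K V₁]
    [AddCommGroup V₂] [Module K V₂] [AddCommGroup W] [Module K W] [FiniteDimensional K W]
    (E₁ : V₁ →ₗ[K] W) (E₂ : V₂ →ₗ[K] W) (h₁ : Function.Injective E₁)
    (h₂ : Function.Injective E₂) (hd : Disjoint (LinearMap.range E₁) (LinearMap.range E₂))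
    (u : ι → V₁) (v : ι' → V₂) :
    finrank K (span K (Set.range (Sum.elim (E₁ ∘ u) (E₂ ∘ v)))) =
      finrank K (span K (Set.range u)) + finrank K (span K (Set.range v)) := by
  rw [Set.Sum.elim_range, Set.range_comp, Set.range_comp, Submodule.span_union,
    Submodule.span_image, Submodule.span_image]
  have hd' : Disjoint ((span K (Set.range u)).map E₁) ((span K (Set.range v)).map E₂) :=
    hd.mono LinearMap.map_le_range LinearMap.map_le_range
  have key := Submodule.finrank_sup_add_finrank_inf_eq ((span K (Set.range u)).map E₁)
    ((span K (Set.range v)).map E₂)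
  rw [hd'.eq_bot, finrank_bot, add_zero] at key
  rw [key, ← (Submodule.equivMapOfInjective E₁ h₁ _).finrank_eq,
    ← (Submodule.equivMapOfInjective E₂ h₂ _).finrank_eq]

/-- **Rank of a block-diagonal family of coordinate vectors.** For injections `j₁ : X₁ → Y`,
`j₂ : X₂ → Y` with disjoint images, extending the vectors `u i ∈ K^{X₁}` and `v i' ∈ K^{X₂}` by
zero to `K^Y` gives a family spanning a space of dimension `dim span u + dim span v`
(`rank (A ⊕ B) = rank A + rank B` for the matrices with these rows). [folklore] -/
theorem finrank_span_range_extend {X₁ X₂ Y : Type*} [Finite Y] {j₁ : X₁ → Y} {j₂ : X₂ → Y}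
    (h₁ : Function.Injective j₁) (h₂ : Function.Injective j₂) (h : ∀ x₁ x₂, j₁ x₁ ≠ j₂ x₂)
    (u : ι → X₁ → K) (v : ι' → X₂ → K) :
    finrank K (span K (Set.range (Sum.elim (fun i => Function.extend j₁ (u i) 0)
      (fun i' => Function.extend j₂ (v i') 0)))) =
      finrank K (span K (Set.range u)) + finrank K (span K (Set.range v)) := by
  set E₁ := Function.ExtendByZero.linearMap K j₁ with hE₁
  set E₂ := Function.ExtendByZero.linearMap K j₂ with hE₂
  have on₁ : ∀ f x, E₁ f (j₁ x) = f x := fun f x => h₁.extend_apply f 0 x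
  have on₂ : ∀ f x, E₂ f (j₂ x) = f x := fun f x => h₂.extend_apply f 0 x
  have off₁ : ∀ f y, (∀ x, j₁ x ≠ y) → E₁ f y = 0 := fun f y hy => by
    show Function.extend j₁ f 0 y = 0
    rw [Function.extend_apply' _ _ _ fun ⟨x, hx⟩ => hy x hx]
    rfl
  have off₂ : ∀ f y, (∀ x, j₂ x ≠ y) → E₂ f y = 0 := fun f y hy => by
    show Function.extend j₂ f 0 y = 0
    rw [Function.extend_apply' _ _ _ fun ⟨x, hx⟩ => hy x hx]
    rfl
  have inj₁ : Function.Injective E₁ := fun f g hfg => funext fun x => by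
    rw [← on₁ f x, ← on₁ g x, hfg]
  have inj₂ : Function.Injective E₂ := fun f g hfg => funext fun x => by
    rw [← on₂ f x, ← on₂ g x, hfg]
  have hd : Disjoint (LinearMap.range E₁) (LinearMap.range E₂) := by
    rw [Submodule.disjoint_def]
    rintro _ ⟨f, rfl⟩ ⟨g, hg⟩
    funext y
    rw [Pi.zero_apply]
    by_cases hy : ∃ x, j₁ x = y
    · obtain ⟨x, rfl⟩ := hy
      rw [← hg]
      exact off₂ g (j₁ x) fun x₂ h' => h x x₂ h'.symm
    · exact off₁ f y fun x hx => hy ⟨x, hx⟩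
  haveI : FiniteDimensional K (Y → K) := inferInstance
  exact finrank_span_range_sumElim E₁ E₂ inj₁ inj₂ hd u v

/-- **`ζ⁽¹⁾(s ⊕ t) = ζ⁽¹⁾(s) + ζ⁽¹⁾(t)`**: the slices of `s ⊕ t` are the extensions by zero of the
slices of `s` (to the block `inl κ × inl μ`) and of `t` (to the block `inr κ' × inr μ'`), two
disjoint sets of coordinates (CVZ 2023, Example 1.4: gauge points are additive; Strassen 1988,
(3.10)). [cite: ChristandlVranaZuiddam2023, Example 1.4] -/
theorem flatteningRank_directSum [Fintype κ] [Fintype μ] [Fintype κ'] [Fintype μ']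
    (s : ι → κ → μ → K) (t : ι' → κ' → μ' → K) :
    flatteningRank (directSumTensor s t) = flatteningRank s + flatteningRank t := by
  have h₁ : Function.Injective (Prod.map Sum.inl Sum.inl : κ × μ → (κ ⊕ κ') × (μ ⊕ μ')) :=
    Sum.inl_injective.prodMap Sum.inl_injective
  have h₂ : Function.Injective (Prod.map Sum.inr Sum.inr : κ' × μ' → (κ ⊕ κ') × (μ ⊕ μ')) :=
    Sum.inr_injective.prodMap Sum.inr_injective
  have h : ∀ (x₁ : κ × μ) (x₂ : κ' × μ'),
      (Prod.map Sum.inl Sum.inl x₁ : (κ ⊕ κ') × (μ ⊕ μ')) ≠ Prod.map Sum.inr Sum.inr x₂ := by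
    rintro ⟨b, c⟩ ⟨b', c'⟩ hx
    simp [Prod.ext_iff] at hx
  have key : xSlices (directSumTensor s t) =
      Sum.elim (fun a => Function.extend (Prod.map Sum.inl Sum.inl : κ × μ → (κ ⊕ κ') × (μ ⊕ μ'))
          (xSlices s a) (0 : (κ ⊕ κ') × (μ ⊕ μ') → K))
        (fun a' => Function.extend (Prod.map Sum.inr Sum.inr : κ' × μ' → (κ ⊕ κ') × (μ ⊕ μ'))
          (xSlices t a') (0 : (κ ⊕ κ') × (μ ⊕ μ') → K)) := by
    funext x q
    rcases x with a | a <;> rcases q with ⟨b | b, c | c⟩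
    · exact (h₁.extend_apply (xSlices s a) _ (b, c)).symm
    · rw [Sum.elim_inl, Function.extend_apply' _ _ _ fun ⟨p, hp⟩ => by simp [Prod.ext_iff] at hp]
      rfl
    · rw [Sum.elim_inl, Function.extend_apply' _ _ _ fun ⟨p, hp⟩ => by simp [Prod.ext_iff] at hp]
      rfl
    · rw [Sum.elim_inl, Function.extend_apply' _ _ _ fun ⟨p, hp⟩ => by simp [Prod.ext_iff] at hp]
      rfl
    · rw [Sum.elim_inr, Function.extend_apply' _ _ _ fun ⟨p, hp⟩ => by simp [Prod.ext_iff] at hp]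
      rfl
    · rw [Sum.elim_inr, Function.extend_apply' _ _ _ fun ⟨p, hp⟩ => by simp [Prod.ext_iff] at hp]
      rfl
    · rw [Sum.elim_inr, Function.extend_apply' _ _ _ fun ⟨p, hp⟩ => by simp [Prod.ext_iff] at hp]
      rfl
    · exact (h₂.extend_apply (xSlices t a) _ (b, c)).symm
  unfold flatteningRank
  rw [key, finrank_span_range_extend h₁ h₂ h]

variable (K) in
/-- **`ζ⁽¹⁾(⟨1⟩) = 1`**: the only slice of `⟨1⟩` is the nonzero vector `1 ∈ K^{1×1}` (CVZ 2023,
Example 1.4 with §1.2 (normalisation `ξ(⟨1⟩) = 1`); the general `ζ⁽¹⁾(⟨n⟩) = n` is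
`Literature.Barriers.MatrixMultiplication.flatteningRank_unitTensor`). [cite: ChristandlVranaZuiddam2023, Example 1.4] -/
theorem flatteningRank_unitTensor_one : flatteningRank (unitTensor K 1) = 1 := by
  unfold flatteningRank
  have h : Set.range (xSlices (unitTensor K 1)) = {fun _ => 1} := by
    ext f
    simp only [Set.mem_range, Set.mem_singleton_iff]
    constructor
    · rintro ⟨a, rfl⟩
      funext p
      rw [xSlices_apply, unitTensor_one]
    · rintro rfl
      exact ⟨0, funext fun p => by rw [xSlices_apply, unitTensor_one]⟩
  rw [h]
  exact finrank_span_singleton fun h0 => one_ne_zero (congrFun h0 (0, 0))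

end DirectSum

/-! ## The three gauge points are universal spectral points -/

section GaugePoints

variable (K : Type u) [Field K]

/-- **`ζ⁽¹⁾ ∈ Δ(T)`**: the first flattening rank is a universal spectral point — nonnegative,
additive under `⊕`, multiplicative under `⊗`, `ζ⁽¹⁾(⟨1⟩) = 1`, monotone under restriction
(CVZ 2023, Example 1.4; Strassen 1988, (3.10)). [cite: ChristandlVranaZuiddam2023, Example 1.4] -/
theorem gaugePoint₁_isUniversalSpectralPoint : IsUniversalSpectralPoint K (gaugePoint₁ K) where
  nonneg := by
    intro ι κ μ _ _ _ t
    rw [gaugePoint₁_eq]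
    exact Nat.cast_nonneg _
  map_directSum := by
    intro ι κ μ ι' κ' μ' _ _ _ _ _ _ s t
    rw [gaugePoint₁_eq, gaugePoint₁_eq, gaugePoint₁_eq, flatteningRank_directSum, Nat.cast_add]
  map_kronecker := by
    intro ι κ μ ι' κ' μ' _ _ _ _ _ _ s t
    rw [gaugePoint₁_eq, gaugePoint₁_eq, gaugePoint₁_eq, flatteningRank_kronecker, Nat.cast_mul]
  map_unitTensor_one := by
    rw [gaugePoint₁_eq, flatteningRank_unitTensor_one, Nat.cast_one]
  mono := by
    intro ι κ μ ι' κ' μ' _ _ _ _ _ _ t s h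
    rw [gaugePoint₁_eq, gaugePoint₁_eq]
    exact_mod_cast flatteningRank_mono h

/-- `ζ⁽²⁾(t)` is `ζ⁽¹⁾` of `t` with its first two legs swapped (definitional). [folklore] -/
theorem gaugePoint₂_eq_gaugePoint₁_swap {ι κ μ : Type} (t : ι → κ → μ → K) :
    gaugePoint₂ K t = gaugePoint₁ K (fun b a c => t a b c) := rfl

/-- `ζ⁽³⁾(t)` is `ζ⁽¹⁾` of `t` with its third leg moved to the front (definitional). [folklore] -/
theorem gaugePoint₃_eq_gaugePoint₁_swap {ι κ μ : Type} (t : ι → κ → μ → K) :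
    gaugePoint₃ K t = gaugePoint₁ K (fun c a b => t a b c) := rfl

/-- **`ζ⁽²⁾ ∈ Δ(T)`** (CVZ 2023, Example 1.4), transported from `ζ⁽¹⁾` along the swap of the first
two legs. [cite: ChristandlVranaZuiddam2023, Example 1.4] -/
theorem gaugePoint₂_isUniversalSpectralPoint : IsUniversalSpectralPoint K (gaugePoint₂ K) where
  nonneg := by
    intro ι κ μ _ _ _ t
    rw [gaugePoint₂_eq_gaugePoint₁_swap]
    exact (gaugePoint₁_isUniversalSpectralPoint K).nonneg _
  map_directSum := by
    intro ι κ μ ι' κ' μ' _ _ _ _ _ _ s t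
    rw [gaugePoint₂_eq_gaugePoint₁_swap, gaugePoint₂_eq_gaugePoint₁_swap,
      gaugePoint₂_eq_gaugePoint₁_swap, directSumTensor_swap₁₂]
    exact (gaugePoint₁_isUniversalSpectralPoint K).map_directSum _ _
  map_kronecker := by
    intro ι κ μ ι' κ' μ' _ _ _ _ _ _ s t
    rw [gaugePoint₂_eq_gaugePoint₁_swap, gaugePoint₂_eq_gaugePoint₁_swap,
      gaugePoint₂_eq_gaugePoint₁_swap, kroneckerTensor_swap₁₂]
    exact (gaugePoint₁_isUniversalSpectralPoint K).map_kronecker _ _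
  map_unitTensor_one := by
    rw [gaugePoint₂_eq_gaugePoint₁_swap, unitTensor_one_swap₁₂]
    exact (gaugePoint₁_isUniversalSpectralPoint K).map_unitTensor_one
  mono := by
    intro ι κ μ ι' κ' μ' _ _ _ _ _ _ t s h
    rw [gaugePoint₂_eq_gaugePoint₁_swap, gaugePoint₂_eq_gaugePoint₁_swap]
    exact (gaugePoint₁_isUniversalSpectralPoint K).mono _ _ h.swap₁₂

/-- **`ζ⁽³⁾ ∈ Δ(T)`** (CVZ 2023, Example 1.4), transported from `ζ⁽¹⁾` along the cyclic
permutation of the legs. [cite: ChristandlVranaZuiddam2023, Example 1.4] -/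
theorem gaugePoint₃_isUniversalSpectralPoint : IsUniversalSpectralPoint K (gaugePoint₃ K) where
  nonneg := by
    intro ι κ μ _ _ _ t
    rw [gaugePoint₃_eq_gaugePoint₁_swap]
    exact (gaugePoint₁_isUniversalSpectralPoint K).nonneg _
  map_directSum := by
    intro ι κ μ ι' κ' μ' _ _ _ _ _ _ s t
    rw [gaugePoint₃_eq_gaugePoint₁_swap, gaugePoint₃_eq_gaugePoint₁_swap,
      gaugePoint₃_eq_gaugePoint₁_swap, directSumTensor_swap₁₃]
    exact (gaugePoint₁_isUniversalSpectralPoint K).map_directSum _ _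
  map_kronecker := by
    intro ι κ μ ι' κ' μ' _ _ _ _ _ _ s t
    rw [gaugePoint₃_eq_gaugePoint₁_swap, gaugePoint₃_eq_gaugePoint₁_swap,
      gaugePoint₃_eq_gaugePoint₁_swap, kroneckerTensor_swap₁₃]
    exact (gaugePoint₁_isUniversalSpectralPoint K).map_kronecker _ _
  map_unitTensor_one := by
    rw [gaugePoint₃_eq_gaugePoint₁_swap, unitTensor_one_swap₁₃]
    exact (gaugePoint₁_isUniversalSpectralPoint K).map_unitTensor_one
  mono := by
    intro ι κ μ ι' κ' μ' _ _ _ _ _ _ t s h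
    rw [gaugePoint₃_eq_gaugePoint₁_swap, gaugePoint₃_eq_gaugePoint₁_swap]
    exact (gaugePoint₁_isUniversalSpectralPoint K).mono _ _ h.swap₁₃

/-- **Discharge of the named fact `gaugePoint_isUniversalSpectralPoint`** (Christandl–Vrana–Zuiddam
2023, Example 1.4 "Gauge points": "The maps `ζ⁽ⁱ⁾` are universal spectral points"; Strassen 1988,
(3.10)): all three flattening ranks are universal spectral points over every field.
[cite: ChristandlVranaZuiddam2023, Example 1.4] -/
theorem gaugePoint_isUniversalSpectralPoint_holds : gaugePoint_isUniversalSpectralPoint K :=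
  ⟨gaugePoint₁_isUniversalSpectralPoint K, gaugePoint₂_isUniversalSpectralPoint K,
    gaugePoint₃_isUniversalSpectralPoint K⟩

/-- **The asymptotic spectrum of all 3-tensors over a field is nonempty** (it contains the gauge
points; CVZ 2023, Example 1.4). [cite: ChristandlVranaZuiddam2023, Example 1.4] -/
theorem asymptoticSpectrum_nonempty : (asymptoticSpectrum K).Nonempty :=
  (gaugePoint_isUniversalSpectralPoint_holds K).nonempty

end GaugePoints

end Literature.Computability.AlgebraicComplexity

end
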